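import Summits.RiemannHypothesis.RiemannHypothesis.Theorems.WeilWindowFlowWindowLipschitzStubComparisonPhase

/-!
# Stub `stub_comparison` (S3) of line `borderline-barrier` for crux `WeilWindowFlow.WindowLipschitz`
(item stmt-RiemannHypothesis-1039, route route-RiemannHypothesis-WeilWindowFlow; registered skeleton
`Summits/RiemannHypothesis/RiemannHypothesis/Cruxes/WindowLipschitz/Lines/borderline-barrier.lean`, rev 2)

**What is proved.** The weak maximum principle of the line: if the explicit two-scale barrier
`B(x) = (log(1/min(a − |x|, d₀)))^{-1/2}` (on the open window, `0` outside) lies in the form domain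
(hypothesis S2a) and is a WEAK supersolution on the edge layer with surplus `c √(log 1/d₀)` for all
small `d₀` (hypothesis S2b ∘ S1), then Weil ground states obey the sharp POINTWISE EDGE LAW
`‖u(x)‖² · log(1/(a − |x|)) ≤ K(b₀, A)` a.e. on the layer `a − d₀ < |x| < a`, uniformly for windows
`a ∈ [b₀, A]` — exactly the conclusion of `cut-dont-squeeze`'s `stub_edgeLaw`.

**Proof.** The landed spine gives finite energy (C2, `stub_groundStateEnergy`), the weak
Euler–Lagrange identity (EL, `stub_eulerLagrange`) and a uniform sup bound `‖u‖ ≤ C_sup` (A,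
`stub_supBound`). For a phase `ζ`, `|ζ| = 1`, put `v = ζu`, `K₁ = C_sup √(log 1/d₀)` and test (EL) with
the truncation `W = (Re v − K₁ B)⁺`, which vanishes a.e. off the layer because `K₁ B = C_sup ≥ Re v` on
the plateau. Writing `Re v = V + K₁B`, the Markov inequality `(ΔV)(ΔV⁺) ≥ 0` gives
`(Δ Re v)(ΔW) ≥ K₁ (ΔB)(ΔW)` inside the archimedean integral (hence `≥ K₁ c √(log 1/d₀) ∫W` by the
weak surplus) and inside every prime atom (`≥ −2 K₁ β₀ S_A ∫W = −2 C_sup S_A ∫ W`), while killing and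
pole terms are `O_{b₀,A}(C_sup ∫ W)`. For `log(1/d₀)` beyond an explicit threshold this forces
`∫ W = 0`, i.e. `Re(ζu) ≤ K₁ B` a.e.; the four phases `±1, ±i` give `‖u‖² ≤ 4K₁²B²`, and on the layer
`B² = 1/log(1/(a − |x|))`.

## References

* H. Chen, T. Weth, *The Dirichlet problem for the logarithmic Laplacian*, CPDE 44 (2019),
  arXiv:1710.03416, §§3–4 (weak maximum principle).
* V. Hernández-Santamaría, L. F. López Ríos, A. Saldaña, arXiv:2401.18033, Thm 1.1 / Thm 2.4
  (boundary behaviour `ℓ^{1/2}` for the logarithmic Laplacian; barrier architecture).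
* P. A. Feulefack, S. Jarohs, T. Weth, arXiv:2010.10448, §3 (the truncation test).
-/

set_option linter.dupNamespace false

noncomputable section

open MeasureTheory Set Filter
open scoped Topology ENNReal NNReal ComplexConjugate

namespace Summit.RiemannHypothesis.RiemannHypothesis.Theorems.WeilWindowFlowWindowLipschitz

open Literature.NumberTheory.LFunctions

/-! ## The edge law -/

/-- **Stub S3 `stub_comparison` — the weak maximum principle: pointwise edge law, exponent `1/2`.**
From the barrier's form-domain membership (S2a) and its weak surplus `c√(log 1/d₀)·∫w ≤ 𝓔_arch(B, w)`
for all small `d₀` (S2b ∘ S1a ∘ S1b), together with the LANDED finite energy (C2), Euler–Lagrange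
identity (EL) and uniform sup bound (A) of ground states (`stub_groundStateEnergy`,
`stub_eulerLagrange`, `stub_supBound`): on `[b₀, A]` there are `K, d₀` with
`‖u(x)‖² log(1/(a−|x|)) ≤ K` for a.e. `x` in the layer `a − d₀ < |x| < a`, for every ground state `u`
of every window `a ∈ [b₀, A]` (test the real E–L identity of `ζu` with
`(Re(ζu) − C_sup√(log 1/d₀)·B)₊`, `stub_comparison_phase`, for the four phases `ζ = ±1, ±i`).
Constants: `C_sup = max(K_A, 1)`, `C_F = |M_{b₀}| + |M_A| + |ε(b₀)| + |ε(A)| + 4e^{2A}(A+½) + 2S_A`,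
`d₀ = min(d₁, b₀/2, exp(−(C_F + 1)/c))`, `K = 4 C_sup² log(1/d₀)`. The floor `0 < b₀` enters
through `C_sup(b₀, A)`, `ε(b₀)` and `d₀ ≤ b₀/2`. (Chen–Weth arXiv:1710.03416 §§3–4;
Hernández-Santamaría–López-Ríos–Saldaña arXiv:2401.18033 Thm 1.1.) -/
theorem stub_comparison :
    (∀ (a d₀ : ℝ) (B : ℝ → ℝ), 0 < d₀ → 2 * d₀ ≤ 1 → d₀ < a →
      (∀ x, B x = if |x| < a then 1 / Real.sqrt (Real.log (1 / min (a - |x|) d₀)) else 0) →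
      Measurable B ∧ (∀ x, 0 ≤ B x ∧ B x ≤ 1 / Real.sqrt (Real.log (1 / d₀))) ∧
        (∀ x, a ≤ |x| → B x = 0) ∧ MemLp (fun x ↦ (B x : ℂ)) 2 ∧
        IntegrableOn (fun t ↦ weilArchDensity t * weilIncrement (fun x ↦ (B x : ℂ)) t) (Ioi 0)) →
    (∃ c d₁ : ℝ, 0 < c ∧ 0 < d₁ ∧ 2 * d₁ ≤ 1 ∧ ∀ (a d₀ : ℝ) (B : ℝ → ℝ), 0 < d₀ → d₀ ≤ d₁ → d₀ < a →
      (∀ x, B x = if |x| < a then 1 / Real.sqrt (Real.log (1 / min (a - |x|) d₀)) else 0) →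
      ∀ w : ℝ → ℝ, MemLp w 2 → (∀ᵐ x : ℝ, 0 ≤ w x) →
        (∀ᵐ x : ℝ, ¬(a - d₀ < |x| ∧ |x| < a) → w x = 0) →
        c * Real.sqrt (Real.log (1 / d₀)) * ∫ x, w x ≤
          ∫ t in Ioi (0 : ℝ), weilArchDensity t * ∫ x, (B (x + t) - B x) * (w (x + t) - w x)) →
    ∀ b₀ A : ℝ, 0 < b₀ → b₀ ≤ A → ∃ K d₀ : ℝ, 0 < d₀ ∧ d₀ < 1 ∧
      ∀ (a : ℝ) (u : ℝ → ℂ), b₀ ≤ a → a ≤ A → IsWeilGroundState a u →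
        ∀ᵐ x : ℝ, a - d₀ < |x| → |x| < a → ‖u x‖ ^ 2 * Real.log (1 / (a - |x|)) ≤ K := by
  intro hBar hWk b₀ A hb₀ hbA
  obtain ⟨c, d₁, hc, hd₁, hd₁1, hweak⟩ := hWk
  have hC2 := stub_groundStateEnergy
  have hEL := stub_eulerLagrange stub_formDomainPos hC2
  obtain ⟨K₀, hK₀⟩ := stub_supBound hC2 hEL b₀ A hb₀ hbA
  -- constants
  set Csup : ℝ := max K₀ 1 with hCsupdef
  have hCsup1 : 1 ≤ Csup := le_max_right _ _
  set SA : ℝ := ∑ n ∈ weilPrimeIndex A, (ArithmeticFunction.vonMangoldt n : ℝ) / Real.sqrt n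
    with hSAdef
  set CF : ℝ := |weilMarkovConstant b₀| + |weilMarkovConstant A| + |weilGroundEnergy b₀| +
    |weilGroundEnergy A| + 4 * Real.exp A ^ 2 * (A + 1 / 2) + 2 * SA with hCFdef
  set d₀ : ℝ := min d₁ (min (b₀ / 2) (Real.exp (-((CF + 1) / c)))) with hd₀def
  have hd₀pos : 0 < d₀ := lt_min hd₁ (lt_min (by linarith) (Real.exp_pos _))
  have hd₀d₁ : d₀ ≤ d₁ := min_le_left _ _
  have hd₀b : d₀ ≤ b₀ / 2 := (min_le_right _ _).trans (min_le_left _ _)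
  have hd₀e : d₀ ≤ Real.exp (-((CF + 1) / c)) := (min_le_right _ _).trans (min_le_right _ _)
  have hd₀1 : d₀ < 1 := by linarith
  have h2d₀ : 2 * d₀ ≤ 1 := by linarith
  have hL₀ : CF + 1 ≤ c * Real.log (1 / d₀) := by
    have h1 : (CF + 1) / c ≤ Real.log (1 / d₀) := by
      rw [one_div, Real.log_inv, le_neg, ← Real.log_exp (-((CF + 1) / c))]
      exact Real.log_le_log hd₀pos hd₀e
    rwa [div_le_iff₀' hc] at h1
  refine ⟨4 * Csup ^ 2 * Real.log (1 / d₀), d₀, hd₀pos, hd₀1, fun a u hba haA hu ↦ ?_⟩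
  have hd₀a : d₀ < a := by linarith
  -- the barrier of this window
  set B : ℝ → ℝ := fun x ↦ if |x| < a then 1 / Real.sqrt (Real.log (1 / min (a - |x|) d₀)) else 0
    with hBdef
  have hB : ∀ x, B x = if |x| < a then 1 / Real.sqrt (Real.log (1 / min (a - |x|) d₀)) else 0 :=
    fun x ↦ rfl
  obtain ⟨hBm, hBb, hB0, hB2, hBE⟩ := hBar a d₀ B hd₀pos h2d₀ hd₀a hB
  have hBp : ∀ x, |x| ≤ a - d₀ → B x = 1 / Real.sqrt (Real.log (1 / d₀)) := by
    intro x hx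
    rw [hB, if_pos (by linarith), min_eq_right (by linarith)]
  have hweak' := hweak a d₀ B hd₀pos hd₀d₁ hd₀a hB
  -- normalise `u` to vanish off the window
  set u' : ℝ → ℂ := (Icc (-a) a).indicator u with hu'
  have hgs : IsWeilGroundState a u' := hu.congr_ae hu.ae_eq_indicator
  have hu'0 : ∀ x, x ∉ Icc (-a) a → u' x = 0 := fun x hx ↦ indicator_of_notMem hx _
  -- the constant `C_F` dominates the window-`a` constants
  have hSa : ∑ n ∈ weilPrimeIndex a, (ArithmeticFunction.vonMangoldt n : ℝ) / Real.sqrt n ≤ SA :=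
    Finset.sum_le_sum_of_subset_of_nonneg (stub_supBound_weilPrimeIndex_mono haA)
      (fun n _ _ ↦ div_nonneg ArithmeticFunction.vonMangoldt_nonneg (Real.sqrt_nonneg _))
  have hMa : |weilMarkovConstant a| ≤ |weilMarkovConstant b₀| + |weilMarkovConstant A| := by
    have h1 := stub_supBound_weilMarkovConstant_mono hba
    have h2 := stub_supBound_weilMarkovConstant_mono haA
    rw [abs_le]
    constructor <;>
      linarith [neg_abs_le (weilMarkovConstant b₀), le_abs_self (weilMarkovConstant A),
        abs_nonneg (weilMarkovConstant b₀), abs_nonneg (weilMarkovConstant A)]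
  have hεa : |weilGroundEnergy a| ≤ |weilGroundEnergy b₀| + |weilGroundEnergy A| := by
    have h1 := stub_supBound_weilGroundEnergy_anti hb₀ hba
    have h2 := stub_supBound_weilGroundEnergy_anti (hb₀.trans_le hba) haA
    rw [abs_le]
    constructor <;>
      linarith [neg_abs_le (weilGroundEnergy A), le_abs_self (weilGroundEnergy b₀),
        abs_nonneg (weilGroundEnergy b₀), abs_nonneg (weilGroundEnergy A)]
  have hCFa : |weilMarkovConstant a| + |weilGroundEnergy a| + 4 * Real.exp A ^ 2 * (A + 1 / 2) +
      2 * (∑ n ∈ weilPrimeIndex a, (ArithmeticFunction.vonMangoldt n : ℝ) / Real.sqrt n) ≤ CF := by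
    rw [hCFdef]
    linarith
  -- one phase at a time
  have key : ∀ ζ : ℂ, ‖ζ‖ = 1 →
      ∀ᵐ x : ℝ, (ζ * u' x).re ≤ Csup * Real.sqrt (Real.log (1 / d₀)) * B x := by
    intro ζ hζ
    have hgsζ : IsWeilGroundState a (fun x ↦ ζ * u' x) := hgs.const_mul hζ
    have hbd : ∀ᵐ x : ℝ, ‖ζ * u' x‖ ≤ Csup := by
      filter_upwards [hK₀ a _ hba haA hgsζ] with x hx
      exact hx.trans (le_max_left _ _)
    exact stub_comparison_phase haA hd₀pos hd₀1 hgsζ (fun x hx ↦ by rw [hu'0 x hx, mul_zero])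
      hCsup1 hbd hBm hBb hB0 hBp hB2 hBE hweak' hCFa hL₀
  have h1 := key 1 (by simp)
  have h2 := key (-1) (by simp)
  have h3 := key Complex.I (by simp)
  have h4 := key (-Complex.I) (by simp)
  filter_upwards [h1, h2, h3, h4, hu.ae_eq_indicator] with x h1 h2 h3 h4 hx hxl hxa
  rw [hx]
  simp only [one_mul, neg_mul, Complex.neg_re, Complex.mul_re, Complex.I_re, Complex.I_im,
    zero_mul, one_mul, zero_sub] at h1 h2 h3 h4
  set K₁ : ℝ := Csup * Real.sqrt (Real.log (1 / d₀)) with hK₁def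
  have hnorm : ‖u' x‖ ≤ 2 * (K₁ * B x) := by
    calc ‖u' x‖ ≤ |(u' x).re| + |(u' x).im| := Complex.norm_le_abs_re_add_abs_im _
      _ ≤ K₁ * B x + K₁ * B x :=
          add_le_add (abs_le.2 ⟨by linarith, h1⟩) (abs_le.2 ⟨by linarith, by linarith⟩)
      _ = 2 * (K₁ * B x) := by ring
  -- on the layer `B x = (log(1/(a - |x|)))^{-1/2}`
  have hdpos : 0 < a - |x| := sub_pos.2 hxa
  have hdlt : a - |x| < d₀ := by linarith
  set ℓ : ℝ := Real.log (1 / (a - |x|)) with hℓdef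
  have hℓpos : 0 < ℓ := Real.log_pos (by rw [lt_div_iff₀ hdpos]; nlinarith)
  have hBx : B x = 1 / Real.sqrt ℓ := by
    rw [hB, if_pos hxa, min_eq_left hdlt.le]
  have hsℓ : 0 < Real.sqrt ℓ := Real.sqrt_pos.2 hℓpos
  have hL₀nn : 0 ≤ Real.log (1 / d₀) := (Real.log_pos (by rw [lt_div_iff₀ hd₀pos]; linarith)).le
  have hsq : ‖u' x‖ ^ 2 ≤ (2 * (K₁ * B x)) ^ 2 := pow_le_pow_left₀ (norm_nonneg _) hnorm 2
  have hK₁sq : K₁ ^ 2 = Csup ^ 2 * Real.log (1 / d₀) := by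
    rw [hK₁def, mul_pow, Real.sq_sqrt hL₀nn]
  have hBsq : B x ^ 2 * ℓ = 1 := by
    rw [hBx, div_pow, one_pow, Real.sq_sqrt hℓpos.le]
    field_simp
  calc ‖u' x‖ ^ 2 * ℓ ≤ (2 * (K₁ * B x)) ^ 2 * ℓ := mul_le_mul_of_nonneg_right hsq hℓpos.le
    _ = 4 * K₁ ^ 2 * (B x ^ 2 * ℓ) := by ring
    _ = 4 * Csup ^ 2 * Real.log (1 / d₀) := by rw [hBsq, hK₁sq, mul_one]; ring

end Summit.RiemannHypothesis.RiemannHypothesis.Theorems.WeilWindowFlowWindowLipschitz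

end
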